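import Summits.KontsevichZagierPeriods.KontsevichZagierPeriods.Theorems.LinRedNormalFormArrangementNormalFormStubRebaseSimpleZeroNestedDiffE1Grid
import Summits.KontsevichZagierPeriods.KontsevichZagierPeriods.Theorems.LinRedNormalFormArrangementNormalFormStubRebaseSimpleZeroNestedDiffE1VertexTools

/-!
# Stub `stub_rebaseSimpleZeroTwo`, part `rebaseSimpleZero_HDiff1_of_HPar1` (crux
`ArrangementNormalForm`, line `janus-bands`) — brick `NestedDiffE1VertexWedge`

**Box-Janus at a pinch vertex with the WEDGE ESTIMATE, and the first vertex case.** For a datum of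
the interval normal form `HDiff₁` (`RebaseE1.IsDN`: clean nest `A(y) < tᵢ < tⱼ < B(y)` over
`{l < y < u}`, inner letter `cᵢ` constant, outer letter `cⱼ` of slope `λ ≠ 0`, base constant
`K ≠ 0`) pinching at the left end (`A(l) = B(l) = t₀`) with a letter THROUGH the vertex, the boxes
of the sub- or super-section Janus touch that letter plane along the vertex line; they still converge
because the singular factor is dominated by `C/(√|Λ₁| √|Λ₂|)` for two independent affine forms
(`RebaseDiff.integrableOn_wedge` in the frames `RebaseE1.wLinY/wLinT`). This brick: the
square-root bookkeeping (`sqrt_mul_sqrt_le_weighted` — weighted AM–GM, `one_div_le_sqrt`,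
`wedge_bound`), the letter margins near the vertex (`inner_margin`, `outer_margin`), and the case
**outer letter through the vertex with `λ > B'`** (`IsDN.good_vtx_outer_above`, registered as
`rebaseSimpleZero_E1vertexOuterAbove`): after the base cut at an explicit mesh (right piece
regular, `IsDN.good_middle`), sub-section Janus at the constant `t₀ − η/2` (`η = |cᵢ − t₀|`); on
its box `cⱼ − tⱼ = (λ − B')(y − l) + (B − tⱼ) ≥ 2√((λ − B')(y − l)(B − tⱼ))`, wedge in the frame
`(tᵢ, tⱼ − B' y, y)`.

References: M. Kontsevich, D. Zagier, *Periods* (2001), §1.2, rules (1a), (2).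
-/

noncomputable section

open Set MeasureTheory MvPolynomial
open Literature.NumberTheory.Transcendental Literature.ModelTheory.ExponentialFields

namespace Summit.KontsevichZagierPeriods.ArrangementNormalForm.JanusBands

namespace RebaseE1

open SeparatePos RebasePos RebaseZero RebaseNest RebaseDiff

variable {i j : Fin 2} {s : KZ.IntegralRep (0 + 1 + 2)} {l u : ℚ} {A B : Cf} {T : BData}
  {p : MvPolynomial (Fin 0) ℚ} {a : Fin 2 → Option Cf} {ci cj : Cf}

/-! ### Square-root bookkeeping -/

/-- `√P √Q ≤ Q` for `0 ≤ P ≤ Q`. [folklore] -/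
theorem sqrt_mul_sqrt_le_of_le {P Q : ℝ} (hP : 0 ≤ P) (hPQ : P ≤ Q) : Real.sqrt P * Real.sqrt Q ≤ Q := by
  have h1 : Real.sqrt P ≤ Real.sqrt Q := Real.sqrt_le_sqrt hPQ
  calc Real.sqrt P * Real.sqrt Q ≤ Real.sqrt Q * Real.sqrt Q :=
        mul_le_mul_of_nonneg_right h1 (Real.sqrt_nonneg _)
    _ = Q := Real.mul_self_sqrt (hP.trans hPQ)

/-- Weighted AM–GM: `√P √Q ≤ (κ P + Q)/(2√κ)`. [folklore] -/
theorem sqrt_mul_sqrt_le_weighted {P Q κ : ℝ} (hκ : 0 < κ) (hP : 0 ≤ P) (hQ : 0 ≤ Q) :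
    Real.sqrt P * Real.sqrt Q ≤ (κ * P + Q) / (2 * Real.sqrt κ) := by
  have hsκ : 0 < Real.sqrt κ := Real.sqrt_pos.2 hκ
  rw [le_div_iff₀ (by positivity)]
  have h1 : Real.sqrt (κ * P) = Real.sqrt κ * Real.sqrt P := Real.sqrt_mul hκ.le P
  have key : 2 * (Real.sqrt (κ * P) * Real.sqrt Q) ≤ κ * P + Q := by
    nlinarith [sq_nonneg (Real.sqrt (κ * P) - Real.sqrt Q), Real.sq_sqrt (by positivity : 0 ≤ κ * P),
      Real.sq_sqrt hQ]
  calc Real.sqrt P * Real.sqrt Q * (2 * Real.sqrt κ) = 2 * (Real.sqrt (κ * P) * Real.sqrt Q) := by rw [h1]; ring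
    _ ≤ κ * P + Q := key

/-- Trading a singular factor for two square roots: `1/P ≤ C/(√|L₁| √|L₂|)` once
`√|L₁| √|L₂| ≤ C P`. [folklore] -/
theorem one_div_le_sqrt {P L₁ L₂ C : ℝ} (hP : 0 < P) (h1 : L₁ ≠ 0) (h2 : L₂ ≠ 0)
    (hle : Real.sqrt |L₁| * Real.sqrt |L₂| ≤ C * P) : 1 / P ≤ C / (Real.sqrt |L₁| * Real.sqrt |L₂|) := by
  have hs : 0 < Real.sqrt |L₁| * Real.sqrt |L₂| :=
    mul_pos (Real.sqrt_pos.2 (abs_pos.2 h1)) (Real.sqrt_pos.2 (abs_pos.2 h2))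
  rw [div_le_div_iff₀ hP hs, one_mul]
  exact hle

/-- The wedge bound of the size `|K| |Y|⁻¹ |P|⁻¹ |Q|⁻¹` of the literal integrand: a margin `ρ` for
the base pole and a bound `(1/g)(C/S)` for the two letter factors. [folklore] -/
theorem wedge_bound {K Y P Q ρ g C S : ℝ} (hρ : 0 < ρ) (hg : 0 < g) (hS : 0 < S) (hY : ρ ≤ |Y|)
    (hPQ : (1 / |P|) * (1 / |Q|) ≤ (1 / g) * (C / S)) :
    |K| * (1 / |Y|) * ((1 / |P|) * (1 / |Q|)) ≤ (|K| * C / (ρ * g)) / S := by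
  have e1 : 1 / |Y| ≤ 1 / ρ := one_div_le_one_div_of_le hρ hY
  calc |K| * (1 / |Y|) * ((1 / |P|) * (1 / |Q|)) ≤ |K| * (1 / ρ) * ((1 / g) * (C / S)) :=
        mul_le_mul (mul_le_mul_of_nonneg_left e1 (abs_nonneg K)) hPQ (by positivity) (by positivity)
    _ = (|K| * C / (ρ * g)) / S := by field_simp

/-- A slope increment near `l`: `|γ (y − l)| ≤ m` once `|γ| δ ≤ m` and `l < y < l + δ`. [folklore] -/
theorem abs_slope_mul_le {γ δ m y l₀ : ℝ} (hγ : |γ| * δ ≤ m) (h1 : l₀ < y) (h2 : y < l₀ + δ) :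
    |γ * (y - l₀)| ≤ m := by
  rw [abs_mul, abs_of_pos (by linarith : (0 : ℝ) < y - l₀)]
  calc |γ| * (y - l₀) ≤ |γ| * δ := mul_le_mul_of_nonneg_left (by linarith) (abs_nonneg _)
    _ ≤ m := hγ

/-- A letter at distance `η` from the vertex level `t₀` (`η = |c − t₀|`) keeps the distance
`3η/8` from every `t` with `t₀ − 5η/8 < t < t₀ + 5η/8`. [folklore] -/
theorem inner_margin {c t₀ η ti : ℝ} (hη : η = |c - t₀|) (hlo : t₀ - 5 * η / 8 < ti) (hhi : ti < t₀ + 5 * η / 8) :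
    3 * η / 8 ≤ |ti - c| := by
  rcases le_or_gt c t₀ with hc | hc
  · rw [abs_of_nonpos (by linarith)] at hη
    rw [abs_of_pos (by linarith)]
    linarith
  · rw [abs_of_pos (by linarith)] at hη
    rw [abs_of_neg (by linarith)]
    linarith

/-- A sloped letter `e + w` (`w` the slope increment, `|w| ≤ η/8`) at distance `η = |e − t₀|` from
the vertex level keeps the distance `η/4` from every `t` with `t₀ − 3η/8 < t < t₀ + 5η/8`.
[folklore] -/
theorem outer_margin {e t₀ η w t : ℝ} (hη : η = |e - t₀|) (hw : |w| ≤ η / 8) (hlo : t₀ - 3 * η / 8 < t)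
    (hhi : t < t₀ + 5 * η / 8) : η / 4 ≤ |t - (e + w)| := by
  obtain ⟨hw1, hw2⟩ := abs_le.1 hw
  rcases le_or_gt e t₀ with hc | hc
  · rw [abs_of_nonpos (by linarith)] at hη
    rw [abs_of_pos (by linarith)]
    linarith
  · rw [abs_of_pos (by linarith)] at hη
    rw [abs_of_neg (by linarith)]
    linarith

/-! ### The outer letter through the vertex from above -/

/-- **Outer letter through the vertex, `λ > B'`.** Sub-section Janus at the constant `t₀ − η/2`
after the base cut; the box converges by the wedge estimate in the frame `(tᵢ, tⱼ − B' y, y)`.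
[Kontsevich–Zagier 2001, §1.2, rules (1a), (2)] -/
theorem IsDN.good_vtx_outer_above (h : IsDN s l u A B T p a i j) (hL : LData T a i j ci cj)
    (hP : HParS T p a i j ci cj) (hK : Kc T p ≠ 0) (hpinch : evq A l = evq B l)
    (hcj : evq cj l = evq A l) (hci : ci.2 ≠ evq A l) (hlam : B.1 (Fin.last 0) < cj.1 (Fin.last 0))
    (hreg : evq A u < evq B u) (hr : T.ℓ₂.2 < l ∨ u < T.ℓ₂.2) : Good 2 (KZ.of s) := by
  have hij := h.ne
  have hadm : T.n₁ = 0 ∨ T.n₂ = 0 := Or.inl hL.n1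
  have _hK := hK
  -- constants
  set t₀ : ℚ := evq A l with ht₀
  set α : ℚ := A.1 (Fin.last 0) with hα
  set β : ℚ := B.1 (Fin.last 0) with hβ
  set lam : ℚ := cj.1 (Fin.last 0) with hlamdef
  set η : ℚ := |ci.2 - t₀| with hη
  have hη0 : 0 < η := abs_pos.2 (sub_ne_zero.2 hci)
  obtain ⟨δ, hδ0, hqu, hαδ, hβδ, -⟩ := exists_mesh h.lu α β lam hη0
  have hlq : l < l + δ := by linarith
  -- cut at `l + δ`; the right piece is regular
  refine h.good_split (l + δ) hlq hqu (fun s₁ h₁ => ?_) fun s₂ h₂ =>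
    h₂.good_middle hL hP hK (h.evq_lt hlq hqu) hreg (hr.imp_left fun hr' => hr'.trans hlq)
  -- real bookkeeping
  have hη0R : (0 : ℝ) < η := by exact_mod_cast hη0
  have hηR : (η : ℝ) = |(ci.2 : ℝ) - t₀| := by rw [hη, Rat.cast_abs, Rat.cast_sub]
  have hαδR : |(α : ℝ)| * δ ≤ η / 8 := by rw [← Rat.cast_abs]; exact_mod_cast hαδ
  have hβδR : |(β : ℝ)| * δ ≤ η / 8 := by rw [← Rat.cast_abs]; exact_mod_cast hβδ
  have hκ : (0 : ℝ) < lam - β := by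
    have h' : β < lam := hlam
    have h'' : (β : ℝ) < lam := by exact_mod_cast h'
    linarith
  have hA : ∀ y : ℝ, ev A y = t₀ + α * (y - l) := fun y => by rw [ev_pinch A l]
  have hB : ∀ y : ℝ, ev B y = t₀ + β * (y - l) := fun y => by rw [ev_pinch B l, ← hpinch]
  have hBv : ∀ y : ℝ, ev B y = β * y + B.2 := fun y => by rw [ev]
  have hC : ∀ y : ℝ, ev cj y = t₀ + lam * (y - l) := fun y => by rw [ev_pinch cj l, hcj]
  -- the section
  set X : Cf := RebaseZero.mk 0 (t₀ - η / 2) with hX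
  have hXv : ∀ y : ℝ, ev X y = t₀ - η / 2 := fun y => by rw [hX, ev_mk_zero]; push_cast; ring
  have hXA : ∀ y : ℝ, (l : ℝ) < y → y < ((l + δ : ℚ) : ℝ) → ev X y < ev A y := fun y h1 h2 => by
    push_cast at h2
    rw [hXv, hA]
    have := (abs_le.1 (abs_slope_mul_le hαδR h1 h2)).1
    linarith
  -- pole margin
  obtain ⟨ρ, hρ, hρle⟩ := pole_margin hr hqu.le
  -- the box converges
  have hWW : IntegrableOn (glitB T p a)
      (gDom 0 2 2 ![RebaseZero.mk 1 (-l), RebaseZero.mk (-1) (l + δ)] (nlo i X) (nhi j B)) := by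
    refine integrableOn_of_wedge (isSemialgebraic_gDom _ _ _ _) (isBounded_nDom_Ioo hij l (l + δ) _ _)
      (isSemialgebraicFunOn_glit (isSemialgebraic_gDom _ _ _ _) _ _ _ _ _ _ _ _) (wLinY j i (β : ℝ))
      (wLinY_det_ne hij.symm _) (B.2 : ℝ) (l : ℝ) (|Kc T p| * (1 / (2 * Real.sqrt (lam - β))) / (ρ * (3 * η / 8)))
      fun z hz hz1 hz2 => ?_
    obtain ⟨-, e1, e2⟩ := wLinY_apply j i (β : ℝ) z
    rw [e1] at hz1 ⊢
    rw [e2] at hz2 ⊢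
    rw [mem_nDom_Ioo hij] at hz
    obtain ⟨⟨hy1, hy2⟩, h3, h4, h5⟩ := hz
    have hY : ρ ≤ |yv z - T.ℓ₂.2| := hρle _ hy1 hy2
    push_cast at hy2
    rw [hXv] at h3
    -- the three factors
    have hBt : tv z j < t₀ + η / 8 := by
      have := (abs_le.1 (abs_slope_mul_le hβδR hy1 hy2)).2
      rw [hB] at h5
      linarith
    have hgi : 3 * (η : ℝ) / 8 ≤ |tv z i - ev ci (yv z)| := by
      rw [ev_of_fst_eq_zero hL.ci0]
      exact inner_margin hηR (by linarith) (by linarith)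
    have hQpos : 0 < ev cj (yv z) - tv z j := by
      rw [hC]
      have : tv z j < t₀ + β * (yv z - l) := by rw [← hB]; exact h5
      nlinarith
    have hL1 : |tv z j - β * yv z - B.2| = ev B (yv z) - tv z j := by
      rw [hBv, abs_of_neg (by rw [hBv] at h5; linarith)]; ring
    have hL2 : |yv z - l| = yv z - l := abs_of_pos (by linarith)
    have hsq : Real.sqrt |tv z j - β * yv z - B.2| * Real.sqrt |yv z - l| ≤
        (1 / (2 * Real.sqrt (lam - β))) * (ev cj (yv z) - tv z j) := by
      rw [hL1, hL2, mul_comm]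
      have key := sqrt_mul_sqrt_le_weighted hκ (by linarith : (0 : ℝ) ≤ yv z - l)
        (by linarith : (0 : ℝ) ≤ ev B (yv z) - tv z j)
      have e : (lam - β : ℝ) * (yv z - l) + (ev B (yv z) - tv z j) = ev cj (yv z) - tv z j := by
        rw [hB, hC]; ring
      rw [e] at key
      calc Real.sqrt (yv z - l) * Real.sqrt (ev B (yv z) - tv z j)
          ≤ (ev cj (yv z) - tv z j) / (2 * Real.sqrt (lam - β)) := key
        _ = (1 / (2 * Real.sqrt (lam - β))) * (ev cj (yv z) - tv z j) := by ring
    have hgj : 1 / |tv z j - ev cj (yv z)| ≤ (1 / (2 * Real.sqrt (lam - β))) /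
        (Real.sqrt |tv z j - β * yv z - B.2| * Real.sqrt |yv z - l|) := by
      rw [abs_sub_comm, abs_of_pos hQpos]
      exact one_div_le_sqrt hQpos (sub_ne_zero.2 hz1) (sub_ne_zero.2 hz2) hsq
    have hS : 0 < Real.sqrt |tv z j - β * yv z - B.2| * Real.sqrt |yv z - l| :=
      mul_pos (Real.sqrt_pos.2 (abs_pos.2 (sub_ne_zero.2 hz1))) (Real.sqrt_pos.2 (abs_pos.2 (sub_ne_zero.2 hz2)))
    rw [abs_glitB hL p z]
    refine wedge_bound hρ (by positivity) hS hY ?_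
    exact mul_le_mul (one_div_le_one_div_of_le (by positivity) hgi) hgj (by positivity) (by positivity)
  have fT : X.1 (Fin.last 0) = ci.1 (Fin.last 0) := by rw [hX, mk_fst, hL.ci0]
  exact h₁.good_sub hadm X hXA hWW (fun W hW' => hW'.good_par hP (Or.inl fT)) fun r₁ hr₁ =>
    hr₁.good_par hP (Or.inl fT)

end RebaseE1

/-- **Registered brick `rebaseSimpleZero_E1vertexOuterAbove`** (part `rebaseSimpleZero_HDiff1_of_HPar1`
of `stub_rebaseSimpleZeroTwo`, line `janus-bands`): a datum of the interval normal form `HDiff₁`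
(`RebaseE1.IsDN`) with non-zero base constant which pinches at the left end, whose outer letter
passes through the pinch vertex with slope `λ > B'` while the inner letter and the base pole stay
off the vertex, and whose right end is regular, is congruent modulo `KZ.relations` to the subgroup
generated by `GG 0 2 2`, given `HPar1` (`RebaseE1.IsDN.good_vtx_outer_above`: base cut, sub-section
Janus, wedge estimate). [Kontsevich–Zagier 2001, §1.2, rules (1a), (2)] -/
theorem rebaseSimpleZero_E1vertexOuterAbove (i j : Fin 2) (s : KZ.IntegralRep (0 + 1 + 2)) (l u : ℚ) (A B ci cj : (Fin (0 + 1) → ℚ) × ℚ) (T : RebaseZero.BData) (p : MvPolynomial (Fin 0) ℚ) (a : Fin 2 → Option ((Fin (0 + 1) → ℚ) × ℚ)) (h : RebaseE1.IsDN s l u A B T p a i j) (hL : RebaseE1.LData T a i j ci cj) (hP : RebaseE1.HParS T p a i j ci cj) (hK : RebaseDiff.Kc T p ≠ 0) (hpinch : RebaseE1.evq A l = RebaseE1.evq B l) (hcj : RebaseE1.evq cj l = RebaseE1.evq A l) (hci : ci.2 ≠ RebaseE1.evq A l) (hlam : B.1 (Fin.last 0) < cj.1 (Fin.last 0)) (hreg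 : RebaseE1.evq A u < RebaseE1.evq B u) (hr : T.ℓ₂.2 < l ∨ u < T.ℓ₂.2) : RebaseZero.Good 2 (KZ.of s) :=
  h.good_vtx_outer_above hL hP hK hpinch hcj hci hlam hreg hr

end Summit.KontsevichZagierPeriods.ArrangementNormalForm.JanusBands
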